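import Literature.Analysis.ValidatedNumerics.TaylorModelIntegralCert2D
import Literature.Analysis.ValidatedNumerics.TaylorModelBivariateElem
import HarnessLib

/-!
# Double-integral certificates with elementary-function nodes and graph-shaped inner limits

Trunk T-ANA (Analysis/ValidatedNumerics); namespace `Literature.Analysis.ValidatedNumerics.PolyMP`.
Sequel of `TaylorModelIntegralCert2D.lean` (Makino–Berz Algorithm 2 for `∫_{x} ∫_{y} E(x, y)` over a rectangle,
expression language `BExpr` with `exp` only) and `TaylorModelBivariateElem.lean` (the bivariate intrinsics `1/g`,
`√g`, `log g` with acceptance flags).  Three additions, each a thin layer over the landed box estimate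
`abs_integral2_sub_integ2Q_le`:

* **Part A — the certificate made generic in the box rule.**  `stripEnclB / gridEnclB` sum the boxes of any rule
  `β : ℚ → ℚ → MI × Bool` (box centre ↦ enclosure of the box integral, flag) and are sound under `BoxSound S h k f β`;
  `boxEnclG S h k Φ` is the Taylor-model rule of any box modeller `Φ : ℚ → ℚ → IPoly2 × Bool` (centre ↦ model, flag)
  and `certCheck2G` / `integral_bounds_of_certCheck2G` hold for any jointly measurable `f` that `Φ` soundly models
  (`(Φ cx cy).2 = true → TMem2 S h k (f (cx + ·) (cy + ·)) (Φ cx cy).1`): the grid bookkeeping (additivity of the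
  inner integral in `y` on every section, then of the outer integrand in `x`, integrability carried along) is
  proved once, for every present and future expression language;
* **Part A′ — box-split certificates.**  The kernel cost of ONE `decide` over an `n × m` grid was measured to grow
  faster than the number of boxes (the type checker's caches are per declaration: 16 boxes of `1/(1+xy)` at total
  degree 12 cost 146 s in one declaration, 52 s as sixteen), so the certificate is also offered SPLIT: the claimed
  box enclosures `Jss : List (List MI)` are data, `boxCheckG … i j` (box `(i, j)` accepted and inside its claim) is
  one kernel obligation per box — separate `decide`s, hence separate declarations — and `sumCheckG` (positivity,
  `Σ claims ⊆ [lo·S, hi·S]`, evaluated lazily without touching a single Taylor model) is the last;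
  `integral_bounds_of_boxCheckG` has the same conclusion as the one-shot certificate;
* **Part B — the expression language `BExprE`**: `const`, `varX`, `varY`, `neg`, `add`, `sub`, `mul`, `exp`, `log`,
  `inv`, `sqrt` with `toFun₂`, joint measurability, the box model `BExprE.model S h k P cx cy` (parameters
  `P : EPrm`) and `tmem2_model`; `certCheck2E` / `integral_bounds_of_certCheck2E` and the split
  `boxCheckE` / `sumCheckE` / `integral_bounds_of_boxCheckE` = Part A / A′ applied to `BExprE.model` — rational
  functions, square roots and logarithms of the two variables (`g ≠ 0`, resp. `g > 0`, on every box FOLLOWS from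
  acceptance);
* **Part C — graph-shaped inner limits** `∫_{x=a}^{a+2nh} ∫_{y=A(x)}^{B(x)} E(x, y) dy dx` for expressions `A`, `B`
  in `x` alone: the substitution `y = A(x) + t (B(x) − A(x))`, `t ∈ [0, 1]` (Mathlib
  `intervalIntegral.smul_integral_comp_mul_add`, valid for every sign of `B − A`) turns the region under a graph
  into the rectangle `[a, a + 2nh] × [0, 1]` with the integrand `graphIntegrand E A B = E(x, A + t(B − A))·(B − A)`
  — again a `BExprE` (`substY`) — so `certCheck2Graph` is `certCheck2E` on that rectangle and
  `integral_bounds_of_certCheck2Graph` (split form `integral_bounds_of_boxCheckGraph`) needs no new analysis.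
  Simplices, discs cut into graph pieces and Feynman-parameter domains `{0 ≤ y ≤ 1 − x}` are thereby in scope.

Deliberately NOT here: trigonometric nodes, adaptive or non-uniform grids, dimension `≥ 3`, singular integrands
(an endpoint singularity must be subtracted analytically before certification).  Problem-independent; no facts,
no axioms; all certificate data computable over `ℤ`.

## References

* K. Makino, M. Berz, *Taylor models and other validated functional inclusion methods*, Int. J. Pure Appl.
  Math. 4 (2003) 379–456: Algorithm 2 (Quadrature with Taylor Models: identity models, code list in Taylor-model
  arithmetic, exact integration of the polynomial part, `∫_D f ⊂ ∫_D P + |D|·I`), Definition 3 (intrinsics).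
  [cite: MakinoBerz2003, Algorithm 2] [cite: MakinoBerz2003, Definition 3]
* M. Berz, K. Makino, *New methods for high-dimensional verified quadrature*, Reliable Computing 5 (1999) 13–22,
  Sect. 2 (multidimensional Taylor-model quadrature over boxes). [cite: BerzMakino1999, Sect. 2]
* A. Mahboubi, G. Melquiond, T. Sibut-Pinote, *Formally verified approximations of definite integrals*, ITP 2016,
  LNCS 9807, 274–289: Sect. 3.2 Lemma 3 (polynomial enclosure of the integral), Sect. 3.3 (decomposition of the
  domain; enclosures checked by computation). [cite: MahboubiMelquiondSibutpinote2016, Sect. 3.2 Lemma 3]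
* The affine change of variables in an interval integral (Mathlib `intervalIntegral.smul_integral_comp_mul_add`).
  [folklore]
-/

open MeasureTheory intervalIntegral Set
open scoped Interval

namespace Literature.Analysis.ValidatedNumerics

namespace PolyMP

open Literature.Analysis.ValidatedNumerics.NumericsMP
open Literature.Analysis.ValidatedNumerics.ExpPoly (Poly)
open Literature.Analysis.ValidatedNumerics.ExpPoly

/-! ### Part A. The grid certificate, generic in the box modeller -/

/-- **One box, generic**: `Φ cx cy` = (box model of `(u, v) ↦ f(cx + u, cy + v)` on `|u| ≤ h, |v| ≤ k`, flag); the
enclosure is the exact integral of the midpoint rows widened by the box error `⌈B·4hk⌉`.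
[cite: MakinoBerz2003, Algorithm 2] -/
def boxEnclG (S : ℕ) (h k : ℚ) (Φ : ℚ → ℚ → IPoly2 × Bool) (cx cy : ℚ) : MI × Bool :=
  let r := Φ cx cy
  let p := midRows S r.1
  (MI.widen (ofRat S (integ2Q p h k)) (boxErr h k (tabs2 S h k (tsub2 r.1 (ratPoly2 S p)))), r.2)

/-- **Soundness shape of a box rule** `β : centre ↦ (enclosure, flag)` for `f` on boxes of half-widths `h`, `k`:
an accepted box encloses `∫_{-h}^{h} ∫_{-k}^{k} f(cx + u, cy + v) dv du`, the inner integral is interval-integrable in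
`u` and every section `|u| ≤ h` is interval-integrable in `v` (step 4 of op. cit. Algorithm 2, per box).
[cite: MakinoBerz2003, Algorithm 2] -/
def BoxSound (S : ℕ) (h k : ℚ) (f : ℝ → ℝ → ℝ) (β : ℚ → ℚ → MI × Bool) : Prop :=
  ∀ cx cy : ℚ, (β cx cy).2 = true →
    MI.mem S (∫ u in (-(h : ℝ))..h, ∫ v in (-(k : ℝ))..k, f ((cx : ℝ) + u) ((cy : ℝ) + v)) (β cx cy).1 ∧
      IntervalIntegrable (fun u => ∫ v in (-(k : ℝ))..k, f ((cx : ℝ) + u) ((cy : ℝ) + v)) volume (-(h : ℝ)) h ∧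
      ∀ u : ℝ, |u| ≤ h → IntervalIntegrable (fun v => f ((cx : ℝ) + u) ((cy : ℝ) + v)) volume (-(k : ℝ)) k

/-- [folklore] -/
private theorem mem_zeroMI_g (S : ℕ) : MI.mem S 0 ⟨0, 0⟩ := by simp [MI.mem]

/-- [folklore] -/
private theorem boxEnclG_sound {S : ℕ} (hS : 0 < S) {h k : ℚ} (h0 : 0 < h) (k0 : 0 < k) {f : ℝ → ℝ → ℝ}
    (hf : Measurable fun z : ℝ × ℝ => f z.1 z.2) {Φ : ℚ → ℚ → IPoly2 × Bool}
    (hΦ : ∀ cx cy : ℚ, (Φ cx cy).2 = true → TMem2 S h k (fun u v => f ((cx : ℝ) + u) ((cy : ℝ) + v)) (Φ cx cy).1) :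
    BoxSound S h k f (boxEnclG S h k Φ) := by
  intro cx cy hok
  simp only [boxEnclG] at hok ⊢
  have hT := hΦ cx cy hok
  have hm : Measurable fun z : ℝ × ℝ => f ((cx : ℝ) + z.1) ((cy : ℝ) + z.2) :=
    hf.comp ((measurable_const.add measurable_fst).prodMk (measurable_const.add measurable_snd))
  obtain ⟨hest, hI, hσ⟩ := abs_integral2_sub_integ2Q_le hS h0.le k0.le hm hT (midRows S (Φ cx cy).1)
  refine ⟨MI.mem_widen (mem_ofRat S _) ?_, hI, hσ⟩
  have hSr : (0 : ℝ) < S := by exact_mod_cast hS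
  set B : ℤ := tabs2 S h k (tsub2 (Φ cx cy).1 (ratPoly2 S (midRows S (Φ cx cy).1))) with hB
  have h1 := mul_le_mul_of_nonneg_right hest hSr.le
  have h2 : (B : ℝ) / S * (2 * k) * (2 * h) * S = (((B : ℚ) * (4 * h * k) : ℚ) : ℝ) := by
    push_cast; field_simp; ring
  have h3 : (((B : ℚ) * (4 * h * k) : ℚ) : ℝ) ≤ (boxErr h k B : ℝ) := by
    unfold boxErr; exact_mod_cast Int.le_ceil _
  rw [h2] at h1
  exact h1.trans h3

/-- **A column of boxes over a box rule**: x-centre `cx`, `m` y-panels of half-width `k` from `y = a`; summed,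
conjunctive flag. [cite: MakinoBerz2003, Algorithm 2] -/
def stripEnclB (k : ℚ) (β : ℚ → ℚ → MI × Bool) (cx : ℚ) : ℚ → ℕ → MI × Bool
  | _, 0 => (⟨0, 0⟩, true)
  | a, m + 1 =>
      let b := β cx (a + k)
      let s := stripEnclB k β cx (a + 2 * k) m
      (MI.add b.1 s.1, b.2 && s.2)

/-- [folklore] -/
private theorem stripEnclB_sound {S : ℕ} {h k : ℚ} (h0 : 0 < h) {f : ℝ → ℝ → ℝ} {β : ℚ → ℚ → MI × Bool}
    (HB : BoxSound S h k f β) (cx : ℚ) : ∀ (m : ℕ) (a : ℚ), (stripEnclB k β cx a m).2 = true →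
      MI.mem S (∫ u in (-(h : ℝ))..h, ∫ y in (a : ℝ)..((a : ℝ) + 2 * m * k), f ((cx : ℝ) + u) y)
          (stripEnclB k β cx a m).1 ∧
        IntervalIntegrable (fun u => ∫ y in (a : ℝ)..((a : ℝ) + 2 * m * k), f ((cx : ℝ) + u) y)
          volume (-(h : ℝ)) h ∧
        ∀ u : ℝ, |u| ≤ h →
          IntervalIntegrable (fun y => f ((cx : ℝ) + u) y) volume (a : ℝ) ((a : ℝ) + 2 * m * k)
  | 0, a, _ => by
      simp only [Nat.cast_zero, mul_zero, zero_mul, add_zero, intervalIntegral.integral_same,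
        intervalIntegral.integral_zero, stripEnclB]
      exact ⟨mem_zeroMI_g S, intervalIntegrable_const, fun u _ => IntervalIntegrable.refl⟩
  | m + 1, a, hok => by
      have hhr : (0 : ℝ) ≤ h := by exact_mod_cast h0.le
      have hhh : (-(h : ℝ)) ≤ h := by linarith
      simp only [stripEnclB, Bool.and_eq_true] at hok ⊢
      obtain ⟨hb, hs⟩ := hok
      obtain ⟨hbm, hbI, hbσ⟩ := HB cx (a + k) hb
      obtain ⟨ihm, ihI, ihσ⟩ := stripEnclB_sound h0 HB cx m (a + 2 * k) hs
      have el : ((a + 2 * k : ℚ) : ℝ) = (a : ℝ) + 2 * k := by push_cast; ring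
      have er : ((a + 2 * k : ℚ) : ℝ) + 2 * (m : ℝ) * k = (a : ℝ) + 2 * ((m + 1 : ℕ) : ℝ) * k := by
        push_cast; ring
      rw [er, el] at ihm ihI ihσ
      have e1 : ((a + k : ℚ) : ℝ) + -(k : ℝ) = (a : ℝ) := by push_cast; ring
      have e2 : ((a + k : ℚ) : ℝ) + (k : ℝ) = (a : ℝ) + 2 * k := by push_cast; ring
      have hfirst : ∀ u : ℝ, |u| ≤ h →
          IntervalIntegrable (fun y => f ((cx : ℝ) + u) y) volume (a : ℝ) ((a : ℝ) + 2 * k) := by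
        intro u hu
        have h1 := (hbσ u hu).comp_sub_right ((a + k : ℚ) : ℝ)
        have e0 : (fun y => f ((cx : ℝ) + u) (((a + k : ℚ) : ℝ) + (y - ((a + k : ℚ) : ℝ)))) =
            fun y => f ((cx : ℝ) + u) y := by
          funext y; simp only [add_sub_cancel]
        have ea : -(k : ℝ) + ((a + k : ℚ) : ℝ) = (a : ℝ) := by push_cast; ring
        have eb : (k : ℝ) + ((a + k : ℚ) : ℝ) = (a : ℝ) + 2 * k := by push_cast; ring
        rw [e0, ea, eb] at h1
        exact h1
      have ebox : (fun u => ∫ v in (-(k : ℝ))..k, f ((cx : ℝ) + u) (((a + k : ℚ) : ℝ) + v)) =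
          fun u => ∫ y in (a : ℝ)..((a : ℝ) + 2 * k), f ((cx : ℝ) + u) y := by
        funext u
        rw [intervalIntegral.integral_comp_add_left (fun y => f ((cx : ℝ) + u) y) ((a + k : ℚ) : ℝ), e1, e2]
      rw [ebox] at hbm hbI
      have heqOn : EqOn
          (fun u => (∫ y in (a : ℝ)..((a : ℝ) + 2 * k), f ((cx : ℝ) + u) y) +
            ∫ y in ((a : ℝ) + 2 * k)..((a : ℝ) + 2 * ((m + 1 : ℕ) : ℝ) * k), f ((cx : ℝ) + u) y)
          (fun u => ∫ y in (a : ℝ)..((a : ℝ) + 2 * ((m + 1 : ℕ) : ℝ) * k), f ((cx : ℝ) + u) y)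
          (uIcc (-(h : ℝ)) h) := by
        intro u hu
        rw [uIcc_of_le hhh] at hu
        have hu' : |u| ≤ h := abs_le.2 ⟨hu.1, hu.2⟩
        exact intervalIntegral.integral_add_adjacent_intervals (hfirst u hu') (ihσ u hu')
      refine ⟨?_, ?_, fun u hu => (hfirst u hu).trans (ihσ u hu)⟩
      · rw [← intervalIntegral.integral_congr heqOn, intervalIntegral.integral_add hbI ihI]
        exact MI.mem_add hbm ihm
      · exact (hbI.add ihI).congr fun u hu => heqOn (uIoc_subset_uIcc hu)

/-- **The grid over a box rule**: `n` columns of half-width `h` from `x = a`, each a column of `m` boxes from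
`y = ay`; summed, conjunctive flag. [cite: MakinoBerz2003, Algorithm 2] -/
def gridEnclB (h k : ℚ) (β : ℚ → ℚ → MI × Bool) (ay : ℚ) (m : ℕ) : ℚ → ℕ → MI × Bool
  | _, 0 => (⟨0, 0⟩, true)
  | a, n + 1 =>
      let s := stripEnclB k β (a + h) ay m
      let g := gridEnclB h k β ay m (a + 2 * h) n
      (MI.add s.1 g.1, s.2 && g.2)

/-- [folklore] -/
private theorem gridEnclB_sound {S : ℕ} {h k : ℚ} (h0 : 0 < h) {f : ℝ → ℝ → ℝ} {β : ℚ → ℚ → MI × Bool}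
    (HB : BoxSound S h k f β) (ay : ℚ) (m : ℕ) : ∀ (n : ℕ) (a : ℚ), (gridEnclB h k β ay m a n).2 = true →
      MI.mem S (∫ x in (a : ℝ)..((a : ℝ) + 2 * n * h), ∫ y in (ay : ℝ)..((ay : ℝ) + 2 * m * k), f x y)
          (gridEnclB h k β ay m a n).1 ∧
        IntervalIntegrable (fun x => ∫ y in (ay : ℝ)..((ay : ℝ) + 2 * m * k), f x y)
          volume (a : ℝ) ((a : ℝ) + 2 * n * h)
  | 0, a, _ => by
      simp only [Nat.cast_zero, mul_zero, zero_mul, add_zero, intervalIntegral.integral_same, gridEnclB]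
      exact ⟨mem_zeroMI_g S, IntervalIntegrable.refl⟩
  | n + 1, a, hok => by
      simp only [gridEnclB, Bool.and_eq_true] at hok ⊢
      obtain ⟨hs, hg⟩ := hok
      obtain ⟨hsm, hsI, -⟩ := stripEnclB_sound h0 HB (a + h) m ay hs
      obtain ⟨ihm, ihI⟩ := gridEnclB_sound h0 HB ay m n (a + 2 * h) hg
      have el : ((a + 2 * h : ℚ) : ℝ) = (a : ℝ) + 2 * h := by push_cast; ring
      have er : ((a + 2 * h : ℚ) : ℝ) + 2 * (n : ℝ) * h = (a : ℝ) + 2 * ((n + 1 : ℕ) : ℝ) * h := by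
        push_cast; ring
      rw [er, el] at ihm ihI
      have e1 : ((a + h : ℚ) : ℝ) + -(h : ℝ) = (a : ℝ) := by push_cast; ring
      have e2 : ((a + h : ℚ) : ℝ) + (h : ℝ) = (a : ℝ) + 2 * h := by push_cast; ring
      have hval : ∫ u in (-(h : ℝ))..h, ∫ y in (ay : ℝ)..((ay : ℝ) + 2 * m * k), f (((a + h : ℚ) : ℝ) + u) y =
          ∫ x in (a : ℝ)..((a : ℝ) + 2 * h), ∫ y in (ay : ℝ)..((ay : ℝ) + 2 * m * k), f x y := by
        rw [intervalIntegral.integral_comp_add_left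
          (fun x => ∫ y in (ay : ℝ)..((ay : ℝ) + 2 * m * k), f x y) ((a + h : ℚ) : ℝ), e1, e2]
      have hI1 : IntervalIntegrable (fun x => ∫ y in (ay : ℝ)..((ay : ℝ) + 2 * m * k), f x y)
          volume (a : ℝ) ((a : ℝ) + 2 * h) := by
        have h1 := hsI.comp_sub_right ((a + h : ℚ) : ℝ)
        have e0 : (fun x => ∫ y in (ay : ℝ)..((ay : ℝ) + 2 * m * k), f (((a + h : ℚ) : ℝ) + (x - ((a + h : ℚ) : ℝ))) y) =
            fun x => ∫ y in (ay : ℝ)..((ay : ℝ) + 2 * m * k), f x y := by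
          funext x; simp only [add_sub_cancel]
        have ea : -(h : ℝ) + ((a + h : ℚ) : ℝ) = (a : ℝ) := by push_cast; ring
        have eb : (h : ℝ) + ((a + h : ℚ) : ℝ) = (a : ℝ) + 2 * h := by push_cast; ring
        rw [e0, ea, eb] at h1
        exact h1
      rw [hval] at hsm
      refine ⟨?_, hI1.trans ihI⟩
      rw [← intervalIntegral.integral_add_adjacent_intervals hI1 ihI]
      exact MI.mem_add hsm ihm

/-- [folklore] -/
private theorem bounds_of_grid {S : ℕ} (hS : 0 < S) {h k : ℚ} (h0 : 0 < h) {f : ℝ → ℝ → ℝ}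
    {β : ℚ → ℚ → MI × Bool} (HB : BoxSound S h k f β) {ax ay : ℚ} {n m : ℕ} {lo hi : ℚ}
    (hok : (gridEnclB h k β ay m ax n).2 = true) (hlo : lo * S ≤ ((gridEnclB h k β ay m ax n).1.lo : ℚ))
    (hhi : ((gridEnclB h k β ay m ax n).1.hi : ℚ) ≤ hi * S) :
    (lo : ℝ) ≤ ∫ x in (ax : ℝ)..((ax : ℝ) + 2 * n * h), ∫ y in (ay : ℝ)..((ay : ℝ) + 2 * m * k), f x y ∧
      ∫ x in (ax : ℝ)..((ax : ℝ) + 2 * n * h), ∫ y in (ay : ℝ)..((ay : ℝ) + 2 * m * k), f x y ≤ (hi : ℝ) := by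
  obtain ⟨⟨h1, h2⟩, -⟩ := gridEnclB_sound h0 HB ay m n ax hok
  have hSr : (0 : ℝ) < S := by exact_mod_cast hS
  have hloR : (lo : ℝ) * S ≤ ((gridEnclB h k β ay m ax n).1.lo : ℝ) := by exact_mod_cast hlo
  have hhiR : ((gridEnclB h k β ay m ax n).1.hi : ℝ) ≤ (hi : ℝ) * S := by exact_mod_cast hhi
  exact ⟨le_of_mul_le_mul_right (hloR.trans h1) hSr, le_of_mul_le_mul_right (h2.trans hhiR) hSr⟩

/-- **The generic one-shot certificate** for `lo ≤ ∫_{ax}^{ax+2nh} ∫_{ay}^{ay+2mk} f ≤ hi`: positivity of `S`, `h`,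
`k`, every box accepted, kernel enclosure inside `[lo·S, hi·S]`. [cite: MakinoBerz2003, Algorithm 2] -/
def certCheck2G (S : ℕ) (h k : ℚ) (Φ : ℚ → ℚ → IPoly2 × Bool) (ax ay : ℚ) (n m : ℕ) (lo hi : ℚ) : Bool :=
  let g := gridEnclB h k (boxEnclG S h k Φ) ay m ax n
  decide (0 < S) && decide (0 < h) && decide (0 < k) && g.2 &&
    decide (lo * S ≤ (g.1.lo : ℚ)) && decide ((g.1.hi : ℚ) ≤ hi * S)

/-- **Soundness of the generic one-shot certificate**: for every jointly measurable `f` soundly modelled by `Φ`.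
[cite: MakinoBerz2003, Algorithm 2] [cite: MahboubiMelquiondSibutpinote2016, Sect. 3.2 Lemma 3] -/
theorem integral_bounds_of_certCheck2G {S : ℕ} {h k : ℚ} {f : ℝ → ℝ → ℝ} (hf : Measurable fun z : ℝ × ℝ => f z.1 z.2)
    {Φ : ℚ → ℚ → IPoly2 × Bool}
    (hΦ : ∀ cx cy : ℚ, (Φ cx cy).2 = true → TMem2 S h k (fun u v => f ((cx : ℝ) + u) ((cy : ℝ) + v)) (Φ cx cy).1)
    {ax ay : ℚ} {n m : ℕ} {lo hi : ℚ} (hc : certCheck2G S h k Φ ax ay n m lo hi = true) :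
    (lo : ℝ) ≤ ∫ x in (ax : ℝ)..((ax : ℝ) + 2 * n * h), ∫ y in (ay : ℝ)..((ay : ℝ) + 2 * m * k), f x y ∧
      ∫ x in (ax : ℝ)..((ax : ℝ) + 2 * n * h), ∫ y in (ay : ℝ)..((ay : ℝ) + 2 * m * k), f x y ≤ (hi : ℝ) := by
  unfold certCheck2G at hc
  simp only [Bool.and_eq_true, decide_eq_true_eq] at hc
  obtain ⟨⟨⟨⟨⟨hS, h0⟩, k0⟩, hok⟩, hlo⟩, hhi⟩ := hc
  exact bounds_of_grid hS h0 (boxEnclG_sound hS h0 k0 hf hΦ) hok hlo hhi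

/-! ### Part A′. Box-split certificates (one kernel obligation per box) -/

/-- Centre of panel `i` when panels of half-width `d` are laid from `a`: `a + (2i+1)d`, by the same recursion as
`stripEnclB` / `gridEnclB`. [cite: MakinoBerz2003, Algorithm 2] -/
def panelCentreFrom (d a : ℚ) : ℕ → ℚ
  | 0 => a + d
  | i + 1 => panelCentreFrom d (a + 2 * d) i

/-- **The claimed-box rule**: box centre ↦ (the CLAIMED enclosure `Jss[i][j]` of the box it lies in, flag = the
Taylor-model box `boxEnclG` accepted AND inside the claim).  Its first component is cheap data; all the work sits
in the flag. [cite: MakinoBerz2003, Algorithm 2] -/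
def boxClaimG (S : ℕ) (h k : ℚ) (Φ : ℚ → ℚ → IPoly2 × Bool) (ax ay : ℚ) (Jss : List (List MI)) (cx cy : ℚ) :
    MI × Bool :=
  let J := (Jss.getD (⌊(cx - ax) / (2 * h)⌋.toNat) []).getD (⌊(cy - ay) / (2 * k)⌋.toNat) ⟨0, 0⟩
  let b := boxEnclG S h k Φ cx cy
  (J, b.2 && decide (J.lo ≤ b.1.lo) && decide (b.1.hi ≤ J.hi))

/-- [folklore] -/
private theorem boxClaimG_sound {S : ℕ} (hS : 0 < S) {h k : ℚ} (h0 : 0 < h) (k0 : 0 < k) {f : ℝ → ℝ → ℝ}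
    (hf : Measurable fun z : ℝ × ℝ => f z.1 z.2) {Φ : ℚ → ℚ → IPoly2 × Bool}
    (hΦ : ∀ cx cy : ℚ, (Φ cx cy).2 = true → TMem2 S h k (fun u v => f ((cx : ℝ) + u) ((cy : ℝ) + v)) (Φ cx cy).1)
    (ax ay : ℚ) (Jss : List (List MI)) : BoxSound S h k f (boxClaimG S h k Φ ax ay Jss) := by
  intro cx cy hok
  simp only [boxClaimG, Bool.and_eq_true, decide_eq_true_eq] at hok ⊢
  obtain ⟨⟨hb, hlo⟩, hhi⟩ := hok
  obtain ⟨hm, hI, hσ⟩ := boxEnclG_sound hS h0 k0 hf hΦ cx cy hb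
  refine ⟨⟨?_, ?_⟩, hI, hσ⟩
  · exact le_trans (by exact_mod_cast hlo) hm.1
  · exact le_trans hm.2 (by exact_mod_cast hhi)

/-- **Kernel obligation for box `(i, j)`** (prove each by its own `decide`): the box is accepted and its
Taylor-model enclosure lies inside the claim `Jss[i][j]`. [cite: MakinoBerz2003, Algorithm 2] -/
def boxCheckG (S : ℕ) (h k : ℚ) (Φ : ℚ → ℚ → IPoly2 × Bool) (ax ay : ℚ) (Jss : List (List MI)) (i j : ℕ) :
    Bool :=
  (boxClaimG S h k Φ ax ay Jss (panelCentreFrom h ax i) (panelCentreFrom k ay j)).2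

/-- **Final obligation of a box-split certificate**: positivity of `S`, `h`, `k` and the sum of the claims over the
`n × m` grid inside `[lo·S, hi·S]` (no Taylor model is evaluated). [cite: MakinoBerz2003, Algorithm 2] -/
def sumCheckG (S : ℕ) (h k : ℚ) (Φ : ℚ → ℚ → IPoly2 × Bool) (ax ay : ℚ) (Jss : List (List MI)) (n m : ℕ)
    (lo hi : ℚ) : Bool :=
  let g := gridEnclB h k (boxClaimG S h k Φ ax ay Jss) ay m ax n
  decide (0 < S) && decide (0 < h) && decide (0 < k) &&
    decide (lo * S ≤ (g.1.lo : ℚ)) && decide ((g.1.hi : ℚ) ≤ hi * S)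

/-- [folklore] -/
private theorem stripEnclB_flag (k : ℚ) (β : ℚ → ℚ → MI × Bool) (cx : ℚ) :
    ∀ (m : ℕ) (a : ℚ), (∀ j : ℕ, j < m → (β cx (panelCentreFrom k a j)).2 = true) → (stripEnclB k β cx a m).2 = true
  | 0, _, _ => rfl
  | m + 1, a, H => by
      simp only [stripEnclB, Bool.and_eq_true]
      exact ⟨H 0 (Nat.succ_pos m), stripEnclB_flag k β cx m (a + 2 * k) fun j hj => H (j + 1) (by omega)⟩

/-- [folklore] -/
private theorem gridEnclB_flag (h k : ℚ) (β : ℚ → ℚ → MI × Bool) (ay : ℚ) (m : ℕ) :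
    ∀ (n : ℕ) (a : ℚ), (∀ i j : ℕ, i < n → j < m → (β (panelCentreFrom h a i) (panelCentreFrom k ay j)).2 = true) →
      (gridEnclB h k β ay m a n).2 = true
  | 0, _, _ => rfl
  | n + 1, a, H => by
      simp only [gridEnclB, Bool.and_eq_true]
      exact ⟨stripEnclB_flag k β _ m ay fun j hj => H 0 j (Nat.succ_pos n) hj,
        gridEnclB_flag h k β ay m n (a + 2 * h) fun i j hi hj => H (i + 1) j (by omega) hj⟩

/-- **Soundness of the generic box-split certificate.** [cite: MakinoBerz2003, Algorithm 2]
[cite: MahboubiMelquiondSibutpinote2016, Sect. 3.3] -/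
theorem integral_bounds_of_boxCheckG {S : ℕ} {h k : ℚ} {f : ℝ → ℝ → ℝ} (hf : Measurable fun z : ℝ × ℝ => f z.1 z.2)
    {Φ : ℚ → ℚ → IPoly2 × Bool}
    (hΦ : ∀ cx cy : ℚ, (Φ cx cy).2 = true → TMem2 S h k (fun u v => f ((cx : ℝ) + u) ((cy : ℝ) + v)) (Φ cx cy).1)
    {ax ay : ℚ} {Jss : List (List MI)} {n m : ℕ} {lo hi : ℚ}
    (hbox : ∀ i j : ℕ, i < n → j < m → boxCheckG S h k Φ ax ay Jss i j = true)
    (hsum : sumCheckG S h k Φ ax ay Jss n m lo hi = true) :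
    (lo : ℝ) ≤ ∫ x in (ax : ℝ)..((ax : ℝ) + 2 * n * h), ∫ y in (ay : ℝ)..((ay : ℝ) + 2 * m * k), f x y ∧
      ∫ x in (ax : ℝ)..((ax : ℝ) + 2 * n * h), ∫ y in (ay : ℝ)..((ay : ℝ) + 2 * m * k), f x y ≤ (hi : ℝ) := by
  unfold sumCheckG at hsum
  simp only [Bool.and_eq_true, decide_eq_true_eq] at hsum
  obtain ⟨⟨⟨⟨hS, h0⟩, k0⟩, hlo⟩, hhi⟩ := hsum
  have hok := gridEnclB_flag h k (boxClaimG S h k Φ ax ay Jss) ay m n ax hbox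
  exact bounds_of_grid hS h0 (boxClaimG_sound hS h0 k0 hf hΦ ax ay Jss) hok hlo hhi

/-! ### Part B. The expression language with elementary nodes -/

/-- Integrand expressions in `x`, `y`: rational constants, the variables, `−`, `+`, binary `−`, `·`, `exp`, `log`,
reciprocal and square root (the code list of op. cit. Algorithm 2 over the intrinsics of Definition 3).
[cite: MakinoBerz2003, Algorithm 2] -/
inductive BExprE : Type
  /-- the rational constant `q` -/
  | const (q : ℚ) : BExprE
  /-- the first variable `x` -/
  | varX : BExprE
  /-- the second variable `y` -/
  | varY : BExprE
  /-- `−A` -/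
  | neg (A : BExprE) : BExprE
  /-- `A + B` -/
  | add (A B : BExprE) : BExprE
  /-- `A − B` -/
  | sub (A B : BExprE) : BExprE
  /-- `A · B` -/
  | mul (A B : BExprE) : BExprE
  /-- `e^{A}` -/
  | exp (A : BExprE) : BExprE
  /-- `log A` -/
  | log (A : BExprE) : BExprE
  /-- `1 / A` -/
  | inv (A : BExprE) : BExprE
  /-- `√A` -/
  | sqrt (A : BExprE) : BExprE

/-- Orders and budgets of the box modeller: total degree `D`, series order `K` (exp / log / geometric / binomial
candidates), `Ke` terms and `ke` squarings for the constants `e^{c}`, `Kl` terms for the constants `log c`, `fuel`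
Heron steps for the constants `√c`. [cite: MakinoBerz2003, Algorithm 2] -/
structure EPrm where
  /-- total degree of the box models -/
  D : ℕ
  /-- series order of the intrinsics -/
  K : ℕ
  /-- `atanh`-series terms for `e^{c}` (`MI.expPt`) -/
  Ke : ℕ
  /-- squarings for `e^{c}` (`MI.expPt`) -/
  ke : ℕ
  /-- series terms for `log c` (`MI.logPos`) -/
  Kl : ℕ
  /-- Heron steps for `√c` -/
  fuel : ℕ

namespace BExprE

/-- The real function of two variables denoted by an expression (`log`, `⁻¹`, `√` are Mathlib's total functions).
[cite: MakinoBerz2003, Algorithm 2] -/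
noncomputable def toFun₂ : BExprE → ℝ → ℝ → ℝ
  | const q => fun _ _ => q
  | varX => fun x _ => x
  | varY => fun _ y => y
  | neg A => fun x y => -toFun₂ A x y
  | add A B => fun x y => toFun₂ A x y + toFun₂ B x y
  | sub A B => fun x y => toFun₂ A x y - toFun₂ B x y
  | mul A B => fun x y => toFun₂ A x y * toFun₂ B x y
  | exp A => fun x y => Real.exp (toFun₂ A x y)
  | log A => fun x y => Real.log (toFun₂ A x y)
  | inv A => fun x y => (toFun₂ A x y)⁻¹
  | sqrt A => fun x y => Real.sqrt (toFun₂ A x y)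

/-- Joint (Borel) measurability of the denoted function. [cite: MakinoBerz2003, Algorithm 2] -/
theorem measurable_toFun₂ : ∀ E : BExprE, Measurable fun z : ℝ × ℝ => E.toFun₂ z.1 z.2
  | const _ => measurable_const
  | varX => measurable_fst
  | varY => measurable_snd
  | neg A => (measurable_toFun₂ A).neg
  | add A B => (measurable_toFun₂ A).add (measurable_toFun₂ B)
  | sub A B => (measurable_toFun₂ A).sub (measurable_toFun₂ B)
  | mul A B => (measurable_toFun₂ A).mul (measurable_toFun₂ B)
  | exp A => Real.measurable_exp.comp (measurable_toFun₂ A)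
  | log A => Real.measurable_log.comp (measurable_toFun₂ A)
  | inv A => (measurable_toFun₂ A).inv
  | sqrt A => Real.continuous_sqrt.measurable.comp (measurable_toFun₂ A)

/-- **The box Taylor model of `(u, v) ↦ E(cx + u, cy + v)` on `|u| ≤ h, |v| ≤ k`** with its acceptance flag: the
identity models, then the code list in bivariate Taylor-model arithmetic with the intrinsics of
`TaylorModelBivariate(Elem).lean` (steps 1–2 of op. cit. Algorithm 2). [cite: MakinoBerz2003, Algorithm 2] -/
def model (S : ℕ) (h k : ℚ) (P : EPrm) (cx cy : ℚ) : BExprE → IPoly2 × Bool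
  | const q => (tconst2 (ofRat S q), true)
  | varX => (tvarX2 S (ofRat S cx), true)
  | varY => (tvarY2 S (ofRat S cy), true)
  | neg A =>
      let r := model S h k P cx cy A
      (tneg2 r.1, r.2)
  | add A B =>
      let r := model S h k P cx cy A
      let r' := model S h k P cx cy B
      (tadd2 r.1 r'.1, r.2 && r'.2)
  | sub A B =>
      let r := model S h k P cx cy A
      let r' := model S h k P cx cy B
      (tsub2 r.1 r'.1, r.2 && r'.2)
  | mul A B =>
      let r := model S h k P cx cy A
      let r' := model S h k P cx cy B
      (tmul2 S h k P.D r.1 r'.1, r.2 && r'.2)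
  | exp A =>
      let r := model S h k P cx cy A
      let t := texp2TM S h k P.D P.K P.Ke P.ke r.1
      (t.1, r.2 && t.2)
  | log A =>
      let r := model S h k P cx cy A
      let t := tlog2TM S h k P.D P.K P.Kl r.1
      (t.1, r.2 && t.2)
  | inv A =>
      let r := model S h k P cx cy A
      let t := tinv2TM S h k P.D P.K r.1
      (t.1, r.2 && t.2)
  | sqrt A =>
      let r := model S h k P cx cy A
      let t := tsqrt2TM S h k P.D P.K P.fuel r.1
      (t.1, r.2 && t.2)

/-- **Soundness of `model`**: an accepted box model encloses `(u, v) ↦ E(cx + u, cy + v)` on `|u| ≤ h, |v| ≤ k`.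
[cite: MakinoBerz2003, Algorithm 2] -/
theorem tmem2_model {S : ℕ} (hS : 0 < S) {h k : ℚ} (h0 : 0 ≤ h) (k0 : 0 ≤ k) (P : EPrm) (cx cy : ℚ) :
    ∀ E : BExprE, (model S h k P cx cy E).2 = true →
      TMem2 S h k (fun u v => E.toFun₂ ((cx : ℝ) + u) ((cy : ℝ) + v)) (model S h k P cx cy E).1
  | const q, _ => by simpa [model, toFun₂] using tmem2_const (h := h) (k := k) (mem_ofRat S q)
  | varX, _ => by simpa [model, toFun₂] using tmem2_varX (S := S) (h := h) (k := k) (mem_ofRat S cx)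
  | varY, _ => by simpa [model, toFun₂] using tmem2_varY (S := S) (h := h) (k := k) (mem_ofRat S cy)
  | neg A, hok => by
      simp only [model] at hok ⊢
      exact tmem2_neg (tmem2_model hS h0 k0 P cx cy A hok)
  | add A B, hok => by
      simp only [model, Bool.and_eq_true] at hok ⊢
      exact tmem2_add (tmem2_model hS h0 k0 P cx cy A hok.1) (tmem2_model hS h0 k0 P cx cy B hok.2)
  | sub A B, hok => by
      simp only [model, Bool.and_eq_true] at hok ⊢
      exact tmem2_sub (tmem2_model hS h0 k0 P cx cy A hok.1) (tmem2_model hS h0 k0 P cx cy B hok.2)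
  | mul A B, hok => by
      simp only [model, Bool.and_eq_true] at hok ⊢
      exact tmem2_mul hS h0 k0 P.D (tmem2_model hS h0 k0 P cx cy A hok.1) (tmem2_model hS h0 k0 P cx cy B hok.2)
  | exp A, hok => by
      simp only [model, Bool.and_eq_true] at hok ⊢
      exact tmem2_exp_of_texp2TM hS h0 k0 (tmem2_model hS h0 k0 P cx cy A hok.1) hok.2
  | log A, hok => by
      simp only [model, Bool.and_eq_true] at hok ⊢
      exact tmem2_log_of_tlog2TM hS h0 k0 (tmem2_model hS h0 k0 P cx cy A hok.1) hok.2
  | inv A, hok => by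
      simp only [model, Bool.and_eq_true] at hok ⊢
      exact tmem2_inv_of_tinv2TM hS h0 k0 (tmem2_model hS h0 k0 P cx cy A hok.1) hok.2
  | sqrt A, hok => by
      simp only [model, Bool.and_eq_true] at hok ⊢
      exact tmem2_sqrt_of_tsqrt2TM hS h0 k0 (tmem2_model hS h0 k0 P cx cy A hok.1) hok.2

end BExprE

/-- **The certificate for `BExprE` integrands over a rectangle** (`= certCheck2G` on the box modeller
`BExprE.model`). [cite: MakinoBerz2003, Algorithm 2] -/
def certCheck2E (S : ℕ) (h k : ℚ) (P : EPrm) (E : BExprE) (ax ay : ℚ) (n m : ℕ) (lo hi : ℚ) : Bool :=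
  certCheck2G S h k (fun cx cy => BExprE.model S h k P cx cy E) ax ay n m lo hi

/-- **Soundness** (no side hypotheses): `certCheck2E … = true → lo ≤ ∫_{ax}^{ax+2nh} ∫_{ay}^{ay+2mk} E ≤ hi`.
[cite: MakinoBerz2003, Algorithm 2] [cite: MahboubiMelquiondSibutpinote2016, Sect. 3.2 Lemma 3] -/
theorem integral_bounds_of_certCheck2E {S : ℕ} {h k : ℚ} {P : EPrm} {E : BExprE} {ax ay : ℚ} {n m : ℕ}
    {lo hi : ℚ} (hc : certCheck2E S h k P E ax ay n m lo hi = true) :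
    (lo : ℝ) ≤ ∫ x in (ax : ℝ)..((ax : ℝ) + 2 * n * h), ∫ y in (ay : ℝ)..((ay : ℝ) + 2 * m * k), E.toFun₂ x y ∧
      ∫ x in (ax : ℝ)..((ax : ℝ) + 2 * n * h), ∫ y in (ay : ℝ)..((ay : ℝ) + 2 * m * k), E.toFun₂ x y ≤ (hi : ℝ) := by
  have hS : 0 < S := by
    unfold certCheck2E certCheck2G at hc
    simp only [Bool.and_eq_true, decide_eq_true_eq] at hc
    exact hc.1.1.1.1.1
  have h0 : 0 ≤ h := by
    unfold certCheck2E certCheck2G at hc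
    simp only [Bool.and_eq_true, decide_eq_true_eq] at hc
    exact hc.1.1.1.1.2.le
  have k0 : 0 ≤ k := by
    unfold certCheck2E certCheck2G at hc
    simp only [Bool.and_eq_true, decide_eq_true_eq] at hc
    exact hc.1.1.1.2.le
  exact integral_bounds_of_certCheck2G (BExprE.measurable_toFun₂ E)
    (fun cx cy hok => BExprE.tmem2_model hS h0 k0 P cx cy E hok) hc

/-- **Box-split certificate for `BExprE` integrands, kernel obligation for box `(i, j)`.**
[cite: MakinoBerz2003, Algorithm 2] -/
def boxCheckE (S : ℕ) (h k : ℚ) (P : EPrm) (E : BExprE) (ax ay : ℚ) (Jss : List (List MI)) (i j : ℕ) : Bool :=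
  boxCheckG S h k (fun cx cy => BExprE.model S h k P cx cy E) ax ay Jss i j

/-- **Box-split certificate for `BExprE` integrands, final obligation.** [cite: MakinoBerz2003, Algorithm 2] -/
def sumCheckE (S : ℕ) (h k : ℚ) (P : EPrm) (E : BExprE) (ax ay : ℚ) (Jss : List (List MI)) (n m : ℕ)
    (lo hi : ℚ) : Bool :=
  sumCheckG S h k (fun cx cy => BExprE.model S h k P cx cy E) ax ay Jss n m lo hi

/-- **Soundness of the box-split certificate** (no side hypotheses).
[cite: MakinoBerz2003, Algorithm 2] [cite: MahboubiMelquiondSibutpinote2016, Sect. 3.3] -/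
theorem integral_bounds_of_boxCheckE {S : ℕ} {h k : ℚ} {P : EPrm} {E : BExprE} {ax ay : ℚ}
    {Jss : List (List MI)} {n m : ℕ} {lo hi : ℚ}
    (hbox : ∀ i j : ℕ, i < n → j < m → boxCheckE S h k P E ax ay Jss i j = true)
    (hsum : sumCheckE S h k P E ax ay Jss n m lo hi = true) :
    (lo : ℝ) ≤ ∫ x in (ax : ℝ)..((ax : ℝ) + 2 * n * h), ∫ y in (ay : ℝ)..((ay : ℝ) + 2 * m * k), E.toFun₂ x y ∧
      ∫ x in (ax : ℝ)..((ax : ℝ) + 2 * n * h), ∫ y in (ay : ℝ)..((ay : ℝ) + 2 * m * k), E.toFun₂ x y ≤ (hi : ℝ) := by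
  have hpos : 0 < S ∧ 0 < h ∧ 0 < k := by
    unfold sumCheckE sumCheckG at hsum
    simp only [Bool.and_eq_true, decide_eq_true_eq] at hsum
    exact ⟨hsum.1.1.1.1, hsum.1.1.1.2, hsum.1.1.2⟩
  exact integral_bounds_of_boxCheckG (BExprE.measurable_toFun₂ E)
    (fun cx cy hok => BExprE.tmem2_model hpos.1 hpos.2.1.le hpos.2.2.le P cx cy E hok) hbox hsum

/-! ### Part C. Graph-shaped inner limits by substitution -/

namespace BExprE

/-- Substitute the expression `W` for the second variable. [cite: MakinoBerz2003, Algorithm 2] -/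
def substY (W : BExprE) : BExprE → BExprE
  | const q => const q
  | varX => varX
  | varY => W
  | neg A => neg (substY W A)
  | add A B => add (substY W A) (substY W B)
  | sub A B => sub (substY W A) (substY W B)
  | mul A B => mul (substY W A) (substY W B)
  | exp A => exp (substY W A)
  | log A => log (substY W A)
  | inv A => inv (substY W A)
  | sqrt A => sqrt (substY W A)

/-- [cite: MakinoBerz2003, Algorithm 2] -/
theorem toFun₂_substY (W : BExprE) (x y : ℝ) : ∀ E : BExprE, (substY W E).toFun₂ x y = E.toFun₂ x (W.toFun₂ x y)
  | const _ => rfl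
  | varX => rfl
  | varY => rfl
  | neg A => by simp only [substY, toFun₂, toFun₂_substY W x y A]
  | add A B => by simp only [substY, toFun₂, toFun₂_substY W x y A, toFun₂_substY W x y B]
  | sub A B => by simp only [substY, toFun₂, toFun₂_substY W x y A, toFun₂_substY W x y B]
  | mul A B => by simp only [substY, toFun₂, toFun₂_substY W x y A, toFun₂_substY W x y B]
  | exp A => by simp only [substY, toFun₂, toFun₂_substY W x y A]
  | log A => by simp only [substY, toFun₂, toFun₂_substY W x y A]
  | inv A => by simp only [substY, toFun₂, toFun₂_substY W x y A]
  | sqrt A => by simp only [substY, toFun₂, toFun₂_substY W x y A]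

/-- The expression does not mention the second variable. [cite: MakinoBerz2003, Algorithm 2] -/
def xOnly : BExprE → Bool
  | const _ => true
  | varX => true
  | varY => false
  | neg A => xOnly A
  | add A B => xOnly A && xOnly B
  | sub A B => xOnly A && xOnly B
  | mul A B => xOnly A && xOnly B
  | exp A => xOnly A
  | log A => xOnly A
  | inv A => xOnly A
  | sqrt A => xOnly A

/-- An `xOnly` expression denotes a function of `x` alone. [cite: MakinoBerz2003, Algorithm 2] -/
theorem toFun₂_eq_of_xOnly (x y y' : ℝ) : ∀ A : BExprE, A.xOnly = true → A.toFun₂ x y = A.toFun₂ x y'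
  | const _, _ => rfl
  | varX, _ => rfl
  | varY, h => by simp [xOnly] at h
  | neg A, h => by
      simp only [xOnly] at h
      simp only [toFun₂, toFun₂_eq_of_xOnly x y y' A h]
  | add A B, h => by
      simp only [xOnly, Bool.and_eq_true] at h
      simp only [toFun₂, toFun₂_eq_of_xOnly x y y' A h.1, toFun₂_eq_of_xOnly x y y' B h.2]
  | sub A B, h => by
      simp only [xOnly, Bool.and_eq_true] at h
      simp only [toFun₂, toFun₂_eq_of_xOnly x y y' A h.1, toFun₂_eq_of_xOnly x y y' B h.2]
  | mul A B, h => by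
      simp only [xOnly, Bool.and_eq_true] at h
      simp only [toFun₂, toFun₂_eq_of_xOnly x y y' A h.1, toFun₂_eq_of_xOnly x y y' B h.2]
  | exp A, h => by
      simp only [xOnly] at h
      simp only [toFun₂, toFun₂_eq_of_xOnly x y y' A h]
  | log A, h => by
      simp only [xOnly] at h
      simp only [toFun₂, toFun₂_eq_of_xOnly x y y' A h]
  | inv A, h => by
      simp only [xOnly] at h
      simp only [toFun₂, toFun₂_eq_of_xOnly x y y' A h]
  | sqrt A, h => by
      simp only [xOnly] at h
      simp only [toFun₂, toFun₂_eq_of_xOnly x y y' A h]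

/-- The pulled-back integrand on the unit `t`-interval: `E(x, A + t·(B − A)) · (B − A)` (`t` = the second variable).
[cite: MakinoBerz2003, Algorithm 2] -/
def graphIntegrand (E A B : BExprE) : BExprE :=
  mul (substY (add A (mul varY (sub B A))) E) (sub B A)

end BExprE

/-- **The certificate for a region between two graphs** `lo ≤ ∫_{ax}^{ax+2nh} ∫_{A(x)}^{B(x)} E(x, y) dy dx ≤ hi`:
`A`, `B` mention `x` only, `0 < m`, and `certCheck2E` accepts the pulled-back integrand on
`[ax, ax + 2nh] × [0, 1]` with `t`-panels of half-width `1/(2m)`. [cite: MakinoBerz2003, Algorithm 2] -/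
def certCheck2Graph (S : ℕ) (h : ℚ) (P : EPrm) (E A B : BExprE) (ax : ℚ) (n m : ℕ) (lo hi : ℚ) : Bool :=
  A.xOnly && B.xOnly && decide (0 < m) &&
    certCheck2E S h (1 / (2 * (m : ℚ))) P (BExprE.graphIntegrand E A B) ax 0 n m lo hi

/-- [folklore] -/
private theorem graph_transfer {E A B : BExprE} (hA : A.xOnly = true) (hB : B.xOnly = true) {m : ℕ} (hm : 0 < m)
    (ax : ℝ) (bx : ℝ) :
    ∫ x in ax..bx, ∫ t in ((0 : ℚ) : ℝ)..(((0 : ℚ) : ℝ) + 2 * (m : ℝ) * (((1 / (2 * (m : ℚ))) : ℚ) : ℝ)),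
        (BExprE.graphIntegrand E A B).toFun₂ x t =
      ∫ x in ax..bx, ∫ y in (A.toFun₂ x 0)..(B.toFun₂ x 0), E.toFun₂ x y := by
  have hmr : (0 : ℝ) < m := by exact_mod_cast hm
  have e1 : ((0 : ℚ) : ℝ) + 2 * (m : ℝ) * (((1 / (2 * (m : ℚ))) : ℚ) : ℝ) = 1 := by
    have hm0 : (m : ℝ) ≠ 0 := hmr.ne'
    push_cast
    field_simp
    ring
  have e0 : ((0 : ℚ) : ℝ) = 0 := by push_cast; rfl
  rw [e1, e0]
  refine intervalIntegral.integral_congr fun x _ => ?_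
  have hpt : ∀ t : ℝ, (BExprE.graphIntegrand E A B).toFun₂ x t =
      (B.toFun₂ x 0 - A.toFun₂ x 0) * E.toFun₂ x ((B.toFun₂ x 0 - A.toFun₂ x 0) * t + A.toFun₂ x 0) := by
    intro t
    simp only [BExprE.graphIntegrand, BExprE.toFun₂, BExprE.toFun₂_substY,
      BExprE.toFun₂_eq_of_xOnly x t 0 A hA, BExprE.toFun₂_eq_of_xOnly x t 0 B hB]
    ring_nf
  show ∫ t in (0 : ℝ)..1, (BExprE.graphIntegrand E A B).toFun₂ x t = _
  simp_rw [hpt]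
  rw [intervalIntegral.integral_const_mul, ← smul_eq_mul,
    intervalIntegral.smul_integral_comp_mul_add (fun y => E.toFun₂ x y)]
  simp

/-- **Soundness of the graph certificate** (no side hypotheses; the inner limits may cross — interval integrals
are oriented). The substitution `y = A(x) + t (B(x) − A(x))` is Mathlib's `intervalIntegral.smul_integral_comp_mul_add`.
[cite: MakinoBerz2003, Algorithm 2] [cite: MahboubiMelquiondSibutpinote2016, Sect. 3.2 Lemma 3] -/
theorem integral_bounds_of_certCheck2Graph {S : ℕ} {h : ℚ} {P : EPrm} {E A B : BExprE} {ax : ℚ} {n m : ℕ}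
    {lo hi : ℚ} (hc : certCheck2Graph S h P E A B ax n m lo hi = true) :
    (lo : ℝ) ≤ ∫ x in (ax : ℝ)..((ax : ℝ) + 2 * n * h), ∫ y in (A.toFun₂ x 0)..(B.toFun₂ x 0), E.toFun₂ x y ∧
      ∫ x in (ax : ℝ)..((ax : ℝ) + 2 * n * h), ∫ y in (A.toFun₂ x 0)..(B.toFun₂ x 0), E.toFun₂ x y ≤ (hi : ℝ) := by
  unfold certCheck2Graph at hc
  simp only [Bool.and_eq_true, decide_eq_true_eq] at hc
  obtain ⟨⟨⟨hA, hB⟩, hm⟩, hcert⟩ := hc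
  have hb := integral_bounds_of_certCheck2E hcert
  rw [graph_transfer hA hB hm] at hb
  exact hb

/-- **Soundness of the box-split graph certificate**: `A`, `B` mention `x` only, `0 < m`, every box of the
pulled-back integrand on `[ax, ax + 2nh] × [0, 1]` (t-panels of half-width `1/(2m)`) passes `boxCheckE` against its
claim, and `sumCheckE` holds. [cite: MakinoBerz2003, Algorithm 2] [cite: MahboubiMelquiondSibutpinote2016, Sect. 3.3] -/
theorem integral_bounds_of_boxCheckGraph {S : ℕ} {h : ℚ} {P : EPrm} {E A B : BExprE} {ax : ℚ}
    {Jss : List (List MI)} {n m : ℕ} {lo hi : ℚ} (hA : A.xOnly = true) (hB : B.xOnly = true) (hm : 0 < m)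
    (hbox : ∀ i j : ℕ, i < n → j < m →
      boxCheckE S h (1 / (2 * (m : ℚ))) P (BExprE.graphIntegrand E A B) ax 0 Jss i j = true)
    (hsum : sumCheckE S h (1 / (2 * (m : ℚ))) P (BExprE.graphIntegrand E A B) ax 0 Jss n m lo hi = true) :
    (lo : ℝ) ≤ ∫ x in (ax : ℝ)..((ax : ℝ) + 2 * n * h), ∫ y in (A.toFun₂ x 0)..(B.toFun₂ x 0), E.toFun₂ x y ∧
      ∫ x in (ax : ℝ)..((ax : ℝ) + 2 * n * h), ∫ y in (A.toFun₂ x 0)..(B.toFun₂ x 0), E.toFun₂ x y ≤ (hi : ℝ) := by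
  have hb := integral_bounds_of_boxCheckE hbox hsum
  rw [graph_transfer hA hB hm] at hb
  exact hb

end PolyMP

end Literature.Analysis.ValidatedNumerics
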